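import Summits.CriticalPhenomena.PercolationContinuityZ3.Theorems.Transplant.FKConnectivityAllQForestDetour
import Summits.CriticalPhenomena.PercolationContinuityZ3.Theorems.Transplant.FKConnectivityAllQForestTwoCellBound
import HarnessLib

/-!
# The detour lemma implies the two-cell bound H1′ at every vertex adjacent to BOTH ends `v, y` (the D-rule / weighted triangle inequality)

Support file (`--supports stmt-CriticalPhenomena-4575`), FK sub-lane `prim-bschramm-fk-1` (generation 31) of the post-continuity
programme; builds on p205010 (kernel theorem, internal audit signed; external expert review pending).  No definitions, no named facts,
no sorries; standard axioms.

CONTEXT.  The open node (♣)⁰ = `AdjForestRayleighNoSqOn` is reduced in the kernel (g30, `…ForestTwoCellArrow`) to the local two-cell bound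
H1′ = `TwoCellBoundOn` (`…ForestTwoCellBound`): at a vertex `z ∉ N[o] ∪ {v,y}` with three free pairs `za, zb, zc`, the claw cell is dominated
by one of the three pair cells.  When `{v, y} ⊆ {a, b, c}` ("kvy = 2") the dominating pair is `vy` (the D-rule of memo
bschramm/FROM-fk-1-g30-LAMAN-IDENTITIES.md §4; exhaustive 0 / 5.4·10⁶ at n = 9 with pinned pairs, kit j235134–7 of gen 31), and the D-rule is the
WEIGHTED TRIANGLE INEQUALITY WT on the rest fibre with `t = vy` inserted.

THIS FILE.
* **`forest_triangle_weighted_of_detour`** (WT from DL): on a fibre through the triangle `e = ov, f = oy, t = vy` and for every vertex `w`,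
  `#(o,A) + #((o,A) ∩ {v ≁ w in ω ∆ M}) ≤ #(v,A) + #((v,A) ∩ {o ≁ w in ω}) + #(y,B) + #((y,B) ∩ {o ≁ w in ω ∆ M})` under `DetourOn V`
  (types by the apex of the two triangle pairs in one class; proof: the two exchanges of the triangle theorem carry the first-class event
  `{o ≁ w}`; both are defined off `{o ~ v in ω ∆ M}`, paying the weight 2 there; on `{o ~ v in ω ∆ M}` the deficit is `detour_transfer`).
* **`twoCellIneq_of_detour`**: `DetourOn V →` `TwoCellIneq M' u₀ o v y w v y v y` for every rest fibre `(M', u₀) ∌ vy` with `e, f ∈ M'`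
  (`o, v, y, w` distinct) — by inserting `t` (`fibreCount_insert_one`) the eight cells of `TwoCellIneq` are the six terms of WT (two vanish);
  and **`twoCellBound_kvy2_of_detour`**: under `DetourOn V` the disjunction of `TwoCellBoundOn V` holds at every `(z; a, b, c)` with
  `{v, y} ⊆ {a, b, c}`.  So the kvy = 2 class of H1′ — g30's conjectures WT / D-rule / H2 — needs no two-exchange rule: it is the detour lemma.
[cite: CibulkaHladkyLaCroixWagner2008, Case 3, Table 1 (p. 5)] [cite: SempleWelsh2008, Conj. 1.1 (p. 2); Thm. 4.2 (p. 11)]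
[cite: Linusson2011, Prop. 2.6] [cite: Grimmett2006, §1.5 (p. 13)]
-/

noncomputable section

namespace Summit.CriticalPhenomena.PercolationContinuityZ3.Theorems
namespace FK

open Set Literature.Probability.LatticeModels Literature.Probability.Percolation
open BHK2006 (openGraph_le)
open scoped Classical symmDiff

variable {V : Type*} [Fintype V]

/-! ### The weighted triangle inequality (WT) from the detour lemma -/

section Weighted

variable {M u₀ : BondConfig V} {o v y : V}

/-- Splitting a fibre count along an event of the partner. [cite: Linusson2011, Prop. 2.6] -/
theorem fibreCount_split_right_inter (M u : BondConfig V) (A B E : Set (BondConfig V)) :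
    fibreCount M u A B = fibreCount M u A (B ∩ E) + fibreCount M u A (B ∩ Eᶜ) := by
  rw [← fibreCount_split_right M u A (Set.disjoint_left.2 fun ω h₁ h₂ => h₂.2 h₁.2), ← inter_union_distrib_left,
    union_compl_self, inter_univ]

/-- Splitting a fibre count along an event of the configuration. [cite: Linusson2011, Prop. 2.6] -/
theorem fibreCount_split_left_inter (M u : BondConfig V) (A B E : Set (BondConfig V)) :
    fibreCount M u A B = fibreCount M u (A ∩ E) B + fibreCount M u (A ∩ Eᶜ) B := by
  rw [← fibreCount_split_left M u B (Set.disjoint_left.2 fun ω h₁ h₂ => h₂.2 h₁.2), ← inter_union_distrib_left,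
    union_compl_self, inter_univ]

/-- **THE WEIGHTED TRIANGLE INEQUALITY (WT) from the detour lemma.**  On a fibre `(M, u₀)` through the triangle `e = ov, f = oy, t = vy`
(all in `M`, `o, v, y` distinct) and for every vertex `w`, with the colourings whose first class holds `e` sorted by the apex of the
triangle pair in one class — `(o,A)`: `e,f ∈ ω`; `(v,A)`: `e,t ∈ ω, f ∈ ω ∆ M`; `(y,B)`: `e ∈ ω, f,t ∈ ω ∆ M` —:
`#(o,A) + #((o,A) ∩ {v ≁ w in ω ∆ M}) ≤ #(v,A) + #((v,A) ∩ {o ≁ w in ω}) + #(y,B) + #((y,B) ∩ {o ≁ w in ω ∆ M})`.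
This is the D-rule / two-cell bound H1′ at a vertex with free pairs to `v, y, w` (dominating pair `vy`) read on the fibre with `vy`
inserted (`…ForestTwoCellDetour`).  Proof in the module docstring.
[cite: CibulkaHladkyLaCroixWagner2008, Case 3, Table 1 (p. 5)] [cite: SempleWelsh2008, Conj. 1.1 (p. 2)] [cite: Linusson2011, Prop. 2.6] -/
theorem forest_triangle_weighted_of_detour (hD : DetourOn V) (hd : Disjoint u₀ M) (hov : o ≠ v) (hoy : o ≠ y) (hvy : v ≠ y)
    (heM : s(o, v) ∈ M) (hfM : s(o, y) ∈ M) (htM : s(v, y) ∈ M) (w : V) :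
    fibreCount M u₀ (forestEv V ∩ {ω | s(o, v) ∈ ω ∧ s(o, y) ∈ ω}) (forestEv V) +
      fibreCount M u₀ (forestEv V ∩ {ω | s(o, v) ∈ ω ∧ s(o, y) ∈ ω}) (forestEv V ∩ (reachEv v w)ᶜ) ≤
    fibreCount M u₀ (forestEv V ∩ {ω | s(o, v) ∈ ω} ∩ {ω | s(v, y) ∈ ω}) (forestEv V ∩ {ω | s(o, y) ∈ ω}) +
      fibreCount M u₀ (forestEv V ∩ {ω | s(o, v) ∈ ω} ∩ {ω | s(v, y) ∈ ω} ∩ (reachEv o w)ᶜ) (forestEv V ∩ {ω | s(o, y) ∈ ω}) +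
    (fibreCount M u₀ (forestEv V ∩ {ω | s(o, v) ∈ ω} ∩ {ω | s(v, y) ∉ ω}) (forestEv V ∩ {ω | s(o, y) ∈ ω}) +
      fibreCount M u₀ (forestEv V ∩ {ω | s(o, v) ∈ ω} ∩ {ω | s(v, y) ∉ ω}) (forestEv V ∩ {ω | s(o, y) ∈ ω} ∩ (reachEv o w)ᶜ)) := by
  have hef : s(o, v) ≠ s(o, y) := fun h' => hvy (Sym2.congr_right.1 h')
  -- names
  set P : Set (BondConfig V) := forestEv V ∩ {ω | s(o, v) ∈ ω ∧ s(o, y) ∈ ω} with hP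
  set W : Set (BondConfig V) := (reachEv o w)ᶜ with hW
  set Rov : Set (BondConfig V) := reachEv o v with hRov
  set Cy : Set (BondConfig V) := {η | ¬ (openGraph (η \ {s(v, y)})).Reachable o y} with hCy
  set Cv : Set (BondConfig V) := {η | ¬ (openGraph (η \ {s(v, y)})).Reachable o v} with hCv
  -- facts about a colouring of type (o,A): `t ∉ ω`, `t ∈ ω ∆ M`, `v ≁ y` in `ω ∖ f` and in `ω ∖ e`
  have factA : ∀ ω : BondConfig V, ω \ M = u₀ → ω ∈ P →
      s(v, y) ∉ ω ∧ s(v, y) ∈ ω ∆ M ∧ ¬ (openGraph (ω \ {s(o, y)})).Reachable v y ∧ ¬ (openGraph (ω \ {s(o, v)})).Reachable y v := by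
    rintro ω hω ⟨hF, he, hf⟩
    have ht : s(v, y) ∉ ω := not_mem_of_isForestCfg_of_two_mem hov hoy hvy hF he hf
    exact ⟨ht, Set.mem_symmDiff.2 (Or.inr ⟨htM, ht⟩), not_reachable_sdiff_of_two_mem hov hoy hvy hF he hf,
      not_reachable_sdiff_of_two_mem hoy hov hvy.symm hF hf he⟩
  -- facts about its partner `η ∋ t`: not both `o ~ v` and `o ~ y` off `t`; `o ~ v` in `η` iff one of them
  have factB : ∀ ω : BondConfig V, ω \ M = u₀ → ω ∈ P → ω ∆ M ∈ forestEv V →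
      (ω ∆ M ∈ Cy ∨ ω ∆ M ∈ Cv) ∧ (ω ∆ M ∈ Rov ↔ ¬ (ω ∆ M ∈ Cy ∧ ω ∆ M ∈ Cv)) ∧
        (ω ∆ M ∈ Rov → ((openGraph (ω ∆ M)).Reachable v w ↔ (openGraph (ω ∆ M)).Reachable o w)) := by
    intro ω hω hA hB
    obtain ⟨-, htB, -, -⟩ := factA ω hω hA
    have nb : ¬ ((openGraph ((ω ∆ M) \ {s(v, y)})).Reachable o v ∧ (openGraph ((ω ∆ M) \ {s(v, y)})).Reachable o y) :=
      fun h' => not_reachable_both_sdiff hvy hB htB h'.1 h'.2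
    have hback : insert s(v, y) ((ω ∆ M) \ {s(v, y)}) = ω ∆ M := by rw [insert_sdiff_singleton, insert_eq_of_mem htB]
    have hiff : (openGraph (ω ∆ M)).Reachable o v ↔
        (openGraph ((ω ∆ M) \ {s(v, y)})).Reachable o v ∨ (openGraph ((ω ∆ M) \ {s(v, y)})).Reachable o y := by
      constructor
      · intro h'
        rw [← hback] at h'
        rcases reachable_insert_or_detour _ v y h' with h'' | ⟨h1, h2⟩
        · exact Or.inl h''
        · rcases h1 with h1 | h1
          · exact Or.inl h1
          · exact Or.inr h1
      · rintro (h' | h')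
        · exact h'.mono (openGraph_le sdiff_subset)
        · exact (h'.mono (openGraph_le sdiff_subset)).trans ((openGraph_adj _ _ _).2 ⟨htB, hvy⟩).reachable.symm
    refine ⟨?_, ?_, fun hov' => ?_⟩
    · simp only [hCy, hCv, mem_setOf_eq]; tauto
    · simp only [hRov, mem_reachEv, hCy, hCv, mem_setOf_eq, hiff]; tauto
    · have hov'' : (openGraph (ω ∆ M)).Reachable o v := hov'
      exact ⟨fun h' => hov''.trans h', fun h' => hov''.symm.trans h'⟩
  -- (1) the exchange `f ↔ t` on `Cy`, plain and with the event `W`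
  have X1 : ∀ (X : Set (BondConfig V)), (X = univ ∨ X = W) →
      fibreCount M u₀ (P ∩ X) (forestEv V ∩ Cy) ≤
        fibreCount M u₀ (forestEv V ∩ {ω | s(o, v) ∈ ω} ∩ {ω | s(v, y) ∈ ω} ∩ X) (forestEv V ∩ {ω | s(o, y) ∈ ω}) := by
    intro X hX
    have hXmap : ∀ ω : BondConfig V, s(o, y) ∈ ω → s(o, v) ∈ ω → ω ∈ X → insert s(v, y) (ω \ {s(o, y)}) ∈ X := by
      intro ω hf he hx
      rcases hX with rfl | rfl
      · exact mem_univ _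
      · exact fun h' => hx (reachable_of_reachable_exchange hov hoy he hf h')
    refine le_trans (fibreCount_mono_fibre M u₀ fun ω hω hA hB => ⟨?_, hB.1⟩)
      (fibreCount_exchange_le_event (a := s(o, y)) (b := s(o, v)) (p := y) rfl hoy hvy hfM htM hef.symm X X hXmap)
    obtain ⟨ht, -, hvy', -⟩ := factA ω hω hA.1
    obtain ⟨⟨hF, he, hf⟩, hx⟩ := hA
    exact ⟨⟨⟨hF, hf, he⟩, ht, hvy', hB.2⟩, hx⟩
  -- (2) the exchange `e ↔ t` on `Cv`, then the class swap
  have X2 : ∀ (X : Set (BondConfig V)), (X = univ ∨ X = W) →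
      fibreCount M u₀ (P ∩ X) (forestEv V ∩ Cv) ≤
        fibreCount M u₀ (forestEv V ∩ {ω | s(o, v) ∈ ω} ∩ {ω | s(v, y) ∉ ω}) (forestEv V ∩ {ω | s(o, y) ∈ ω} ∩ X) := by
    intro X hX
    have hXmap : ∀ ω : BondConfig V, s(o, v) ∈ ω → s(o, y) ∈ ω → ω ∈ X → insert s(v, y) (ω \ {s(o, v)}) ∈ X := by
      intro ω he hf hx
      rcases hX with rfl | rfl
      · exact mem_univ _
      · exact fun h' => hx (reachable_of_reachable_exchange hov hoy he hf h')
    have step : fibreCount M u₀ (P ∩ X) (forestEv V ∩ Cv) ≤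
        fibreCount M u₀ (forestEv V ∩ {ω | s(o, y) ∈ ω} ∩ {ω | s(v, y) ∈ ω} ∩ X) (forestEv V ∩ {ω | s(o, v) ∈ ω}) := by
      refine le_trans (fibreCount_mono_fibre M u₀ fun ω hω hA hB => ⟨?_, hB.1⟩)
        (fibreCount_exchange_le_event (a := s(o, v)) (b := s(o, y)) (p := v) rfl hov hvy heM htM hef X X hXmap)
      obtain ⟨ht, -, -, hyv'⟩ := factA ω hω hA.1
      obtain ⟨⟨hF, he, hf⟩, hx⟩ := hA
      exact ⟨⟨⟨hF, he, hf⟩, ht, fun h' => hyv' h'.symm, hB.2⟩, hx⟩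
    refine le_trans step ?_
    rw [fibreCount_swap]
    refine fibreCount_mono_fibre M u₀ fun ω _ hA hB => ⟨⟨⟨hA.1, hA.2⟩, fun h' => ?_⟩, ⟨hB.1.1.1, hB.1.1.2⟩, hB.2⟩
    have hg2 : s(v, y) ∈ ω ∆ M := hB.1.2
    rw [Set.mem_symmDiff] at hg2
    rcases hg2 with ⟨-, h''⟩ | ⟨-, h''⟩
    · exact h'' htM
    · exact h'' h'
  -- (3) counting on the partner side
  have cgr1 : ∀ X : Set (BondConfig V),
      fibreCount M u₀ (P ∩ X) (forestEv V ∩ Cy ∩ Rovᶜ) = fibreCount M u₀ (P ∩ X) (forestEv V ∩ Rovᶜ) := by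
    intro X
    refine fibreCount_congr_fibre M u₀ fun ω hω => ⟨fun h => ⟨h.1, h.2.1.1, h.2.2⟩, fun h => ⟨h.1, ⟨h.2.1, ?_⟩, h.2.2⟩⟩
    have hb := (factB ω hω h.1.1 h.2.1).2.1
    have : ω ∆ M ∈ Cy ∧ ω ∆ M ∈ Cv := by
      by_contra h'
      exact h.2.2 (hb.2 h')
    exact this.1
  have cgr2 : ∀ X : Set (BondConfig V),
      fibreCount M u₀ (P ∩ X) (forestEv V ∩ Cv ∩ Rovᶜ) = fibreCount M u₀ (P ∩ X) (forestEv V ∩ Rovᶜ) := by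
    intro X
    refine fibreCount_congr_fibre M u₀ fun ω hω => ⟨fun h => ⟨h.1, h.2.1.1, h.2.2⟩, fun h => ⟨h.1, ⟨h.2.1, ?_⟩, h.2.2⟩⟩
    have hb := (factB ω hω h.1.1 h.2.1).2.1
    have : ω ∆ M ∈ Cy ∧ ω ∆ M ∈ Cv := by
      by_contra h'
      exact h.2.2 (hb.2 h')
    exact this.2
  have cgr3 : ∀ X : Set (BondConfig V),
      fibreCount M u₀ (P ∩ X) (forestEv V ∩ Rov ∩ Cyᶜ) = fibreCount M u₀ (P ∩ X) (forestEv V ∩ Cv ∩ Rov) := by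
    intro X
    refine fibreCount_congr_fibre M u₀ fun ω hω => ⟨fun h => ⟨h.1, ⟨h.2.1.1, ?_⟩, h.2.1.2⟩, fun h => ⟨h.1, ⟨h.2.1.1, h.2.2⟩, ?_⟩⟩
    · have hb := (factB ω hω h.1.1 h.2.1.1).1
      exact hb.resolve_left h.2.2
    · intro hCy
      have hb := (factB ω hω h.1.1 h.2.1.1).2.1
      exact (hb.1 h.2.2) ⟨hCy, h.2.1.2⟩
  have cgr4 : ∀ X : Set (BondConfig V),
      fibreCount M u₀ (P ∩ X) (forestEv V ∩ Rov ∩ Cy) = fibreCount M u₀ (P ∩ X) (forestEv V ∩ Cy ∩ Rov) := by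
    intro X
    rw [show forestEv V ∩ Rov ∩ Cy = forestEv V ∩ Cy ∩ Rov from inter_right_comm _ _ _]
  have count : ∀ X : Set (BondConfig V),
      fibreCount M u₀ (P ∩ X) (forestEv V ∩ Cy) + fibreCount M u₀ (P ∩ X) (forestEv V ∩ Cv) =
        fibreCount M u₀ (P ∩ X) (forestEv V) + fibreCount M u₀ (P ∩ X) (forestEv V ∩ Rovᶜ) := by
    intro X
    rw [fibreCount_split_right_inter M u₀ (P ∩ X) (forestEv V ∩ Cy) Rov, fibreCount_split_right_inter M u₀ (P ∩ X) (forestEv V ∩ Cv) Rov,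
      fibreCount_split_right_inter M u₀ (P ∩ X) (forestEv V) Rov, fibreCount_split_right_inter M u₀ (P ∩ X) (forestEv V ∩ Rov) Cy,
      cgr1 X, cgr2 X, cgr3 X, cgr4 X]
    omega
  -- (4) the left side along `Rov`
  have lsplit : fibreCount M u₀ P (forestEv V ∩ (reachEv v w)ᶜ) ≤
      fibreCount M u₀ P (forestEv V ∩ Rov ∩ W) + fibreCount M u₀ P (forestEv V ∩ Rovᶜ) := by
    rw [fibreCount_split_right_inter M u₀ P (forestEv V ∩ (reachEv v w)ᶜ) Rov]
    refine Nat.add_le_add (le_of_eq (fibreCount_congr_fibre M u₀ fun ω hω => ⟨fun h => ⟨h.1, ⟨h.2.1.1, h.2.2⟩, ?_⟩,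
      fun h => ⟨h.1, ⟨h.2.1.1, ?_⟩, h.2.1.2⟩⟩)) (fibreCount_mono_fibre M u₀ fun ω _ hA hB => ⟨hA, hB.1.1, hB.2⟩)
    · intro h'
      exact h.2.1.2 (((factB ω hω h.1 h.2.1.1).2.2 h.2.2).2 h')
    · intro h'
      exact h.2.2 (((factB ω hω h.1 h.2.1.1).2.2 h.2.1.2).1 h')
  have lP : fibreCount M u₀ P (forestEv V) = fibreCount M u₀ P (forestEv V ∩ Rov) + fibreCount M u₀ P (forestEv V ∩ Rovᶜ) :=
    fibreCount_split_right_inter M u₀ P (forestEv V) Rov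
  -- (5) DL transported
  have dl : fibreCount M u₀ P (forestEv V ∩ Rov ∩ W) ≤ fibreCount M u₀ (P ∩ W) (forestEv V ∩ Rov) :=
    detour_transfer hD hd hov hoy hvy hfM htM w
  -- (6) assemble
  have hPu : P ∩ univ = P := inter_univ P
  have x1u := X1 univ (Or.inl rfl)
  have x1w := X1 W (Or.inr rfl)
  have x2u := X2 univ (Or.inl rfl)
  have x2w := X2 W (Or.inr rfl)
  have cu := count univ
  have cw := count W
  rw [hPu] at x1u x2u cu
  rw [inter_univ] at x1u x2u
  have mw : fibreCount M u₀ (P ∩ W) (forestEv V ∩ Rov) ≤ fibreCount M u₀ (P ∩ W) (forestEv V) :=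
    fibreCount_mono_fibre M u₀ fun ω _ hA hB => ⟨hA, hB.1⟩
  omega

end Weighted

/-! ### The translation: H1′ for the dominating pair `vy` (kvy = 2) from the detour lemma -/

section TwoCell

variable {M' u₀ : BondConfig V} {o v y w : V}

set_option maxHeartbeats 400000 in
/-- **DL ⇒ H1′ at a vertex adjacent to both ends** (`TwoCellIneq` for the apex `w` and the dominating pair `vy`): for every rest fibre
`(M', u₀)` with `e = ov, f = oy ∈ M'`, `vy ∉ M' ∪ u₀`, `o, v, y` distinct, and every vertex `w`, `DetourOn V` gives
`TwoCellIneq M' u₀ o v y w v y v y` — inserting `t = vy` (`fibreCount_insert_one`) turns the eight cells of `TwoCellIneq` into the six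
terms of the weighted triangle inequality (two cells vanish: the first class holds `e, f`, so it joins `v` to `y`).
[cite: CibulkaHladkyLaCroixWagner2008, Case 3, Table 1 (p. 5)] [cite: SempleWelsh2008, Conj. 1.1 (p. 2)] [cite: Linusson2011, Prop. 2.6] -/
theorem twoCellIneq_of_detour (hD : DetourOn V) (hd : Disjoint u₀ M') (hov : o ≠ v) (hoy : o ≠ y) (hvy : v ≠ y)
    (heM : s(o, v) ∈ M') (hfM : s(o, y) ∈ M') (htM : s(v, y) ∉ M') (htu : s(v, y) ∉ u₀) (w : V) :
    TwoCellIneq M' u₀ o v y w v y v y := by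
  have het : s(o, v) ≠ s(v, y) := fun h' => by
    rcases Sym2.eq_iff.1 h' with ⟨h1, -⟩ | ⟨h1, -⟩
    exacts [hov h1, hoy h1]
  have hft : s(o, y) ≠ s(v, y) := fun h' => hov (Sym2.congr_left.1 h')
  -- the fibre with `t` inserted
  have hd' : Disjoint u₀ (insert s(v, y) M') := Set.disjoint_insert_right.2 ⟨htu, hd⟩
  have WT := forest_triangle_weighted_of_detour (M := insert s(v, y) M') hD hd' hov hoy hvy
    (mem_insert_of_mem _ heM) (mem_insert_of_mem _ hfM) (mem_insert _ _) w
  -- guards and small facts on the rest fibre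
  have hguard : ∀ ω : BondConfig V, ω \ M' = u₀ → s(v, y) ∉ ω ∧ s(v, y) ∉ ω ∆ M' :=
    fun ω hω => notMem_and_notMem_symmDiff_of_fibre htM htu hω
  have hRov : ∀ {ξ : BondConfig V}, s(o, v) ∈ ξ → (openGraph ξ).Reachable o v :=
    fun he => ((openGraph_adj _ _ _).2 ⟨he, hov⟩).reachable
  have hRoy : ∀ {ξ : BondConfig V}, s(o, y) ∈ ξ → (openGraph ξ).Reachable o y :=
    fun hf => ((openGraph_adj _ _ _).2 ⟨hf, hoy⟩).reachable
  have hins : ∀ {ξ : BondConfig V}, s(v, y) ∉ ξ → (IsForestCfg (insert s(v, y) ξ) ↔ IsForestCfg ξ ∧ ¬ (openGraph ξ).Reachable v y) :=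
    fun ht => isForestCfg_insert_iff hvy ht
  have hmem : ∀ {ξ : BondConfig V} {g : Sym2 V}, g ≠ s(v, y) → (g ∈ insert s(v, y) ξ ↔ g ∈ ξ) :=
    fun hg => ⟨fun h => (mem_insert_iff.1 h).resolve_left hg, fun h => mem_insert_of_mem _ h⟩
  -- the two vanishing cells
  have Z1 : fibreCount M' u₀ (forestEv V ∩ sep₃Ev w v y ∩ {ω | s(o, v) ∈ ω ∧ s(o, y) ∈ ω}) (forestEv V ∩ univ) = 0 :=
    fibreCount_eq_zero_of_forall _ _ _ _ fun ω _ hA _ => hA.1.2.2.2 ((hRov hA.2.1).symm.trans (hRoy hA.2.2))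
  have Z2 : fibreCount M' u₀ (forestEv V ∩ sep₂Ev v y ∩ {ω | s(o, v) ∈ ω ∧ s(o, y) ∈ ω}) (forestEv V ∩ univ) = 0 :=
    fibreCount_eq_zero_of_forall _ _ _ _ fun ω _ hA _ => hA.1.2 ((hRov hA.2.1).symm.trans (hRoy hA.2.2))
  -- reachability bookkeeping shared by the six identifications (symmetries and transitivity through `o`)
  have reach_facts : ∀ ξ : BondConfig V,
      ((openGraph ξ).Reachable w v ↔ (openGraph ξ).Reachable v w) ∧ ((openGraph ξ).Reachable w y ↔ (openGraph ξ).Reachable y w) ∧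
      (openGraph ξ).Reachable v v ∧
      ((openGraph ξ).Reachable o v → (openGraph ξ).Reachable o w → (openGraph ξ).Reachable v w) ∧
      ((openGraph ξ).Reachable o v → (openGraph ξ).Reachable v w → (openGraph ξ).Reachable o w) ∧
      ((openGraph ξ).Reachable o y → (openGraph ξ).Reachable o w → (openGraph ξ).Reachable y w) ∧
      ((openGraph ξ).Reachable o y → (openGraph ξ).Reachable y w → (openGraph ξ).Reachable o w) ∧
      ((openGraph ξ).Reachable o v → (openGraph ξ).Reachable o y → (openGraph ξ).Reachable v y) := fun ξ =>
    ⟨⟨SimpleGraph.Reachable.symm, SimpleGraph.Reachable.symm⟩, ⟨SimpleGraph.Reachable.symm, SimpleGraph.Reachable.symm⟩,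
      SimpleGraph.Reachable.refl _, fun h1 h2 => h1.symm.trans h2, fun h1 h2 => h1.trans h2, fun h1 h2 => h1.symm.trans h2,
      fun h1 h2 => h1.trans h2, fun h1 h2 => h1.symm.trans h2⟩
  -- (E1) `#(o,A)` is the pair cell on the second class
  have E1 : fibreCount (insert s(v, y) M') u₀ (forestEv V ∩ {ω | s(o, v) ∈ ω ∧ s(o, y) ∈ ω}) (forestEv V) =
      fibreCount M' u₀ (forestEv V ∩ {ω | s(o, v) ∈ ω ∧ s(o, y) ∈ ω}) (forestEv V ∩ sep₂Ev v y ∩ univ) := by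
    rw [fibreCount_insert_one htM, fibreCount_eq_zero_of_forall _ _ _ _ fun ω _ hA _ =>
      not_mem_of_isForestCfg_of_two_mem hov hoy hvy hA.2.1 hA.2.2.1 hA.2.2.2 (mem_insert _ _), zero_add]
    refine fibreCount_congr_fibre M' u₀ fun ω hω => ?_
    obtain ⟨htω, htη⟩ := hguard ω hω
    simp only [forestEv, sep₂Ev, mem_inter_iff, mem_setOf_eq, mem_univ, and_true, hins htη]
    tauto
  -- (E2) `#((o,A) ∩ {v ≁ w in ω ∆ M})` is the claw cell on the second class
  have E2 : fibreCount (insert s(v, y) M') u₀ (forestEv V ∩ {ω | s(o, v) ∈ ω ∧ s(o, y) ∈ ω}) (forestEv V ∩ (reachEv v w)ᶜ) =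
      fibreCount M' u₀ (forestEv V ∩ {ω | s(o, v) ∈ ω ∧ s(o, y) ∈ ω}) (forestEv V ∩ sep₃Ev w v y ∩ univ) := by
    rw [fibreCount_insert_one htM, fibreCount_eq_zero_of_forall _ _ _ _ fun ω _ hA _ =>
      not_mem_of_isForestCfg_of_two_mem hov hoy hvy hA.2.1 hA.2.2.1 hA.2.2.2 (mem_insert _ _), zero_add]
    refine fibreCount_congr_fibre M' u₀ fun ω hω => ?_
    obtain ⟨htω, htη⟩ := hguard ω hω
    obtain ⟨s1, s2, r0, -, -, -, -, -⟩ := reach_facts (ω ∆ M')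
    clear reach_facts hRov hRoy WT Z1 Z2 E1 hins hmem hguard hd hd' hD
    simp only [forestEv, sep₃Ev, mem_inter_iff, mem_setOf_eq, mem_univ, and_true, isForestCfg_insert_iff hvy htη, mem_compl_iff,
      mem_reachEv, KNSep.reachable_insert_iff]
    tauto
  -- (E3) `#(v,A)` is the pair cell on the first class
  have E3 : fibreCount (insert s(v, y) M') u₀ (forestEv V ∩ {ω | s(o, v) ∈ ω} ∩ {ω | s(v, y) ∈ ω}) (forestEv V ∩ {ω | s(o, y) ∈ ω}) =
      fibreCount M' u₀ (forestEv V ∩ sep₂Ev v y ∩ {ω | s(o, v) ∈ ω}) (forestEv V ∩ {ω | s(o, y) ∈ ω}) := by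
    rw [fibreCount_insert_one htM, fibreCount_eq_zero_of_forall _ _
      ({ω | s(v, y) ∉ ω} ∩ (forestEv V ∩ {ω | s(o, v) ∈ ω} ∩ {ω | s(v, y) ∈ ω})) _ fun ω _ hA _ => hA.1 hA.2.2, add_zero]
    refine fibreCount_congr_fibre M' u₀ fun ω hω => ?_
    obtain ⟨htω, htη⟩ := hguard ω hω
    simp only [forestEv, sep₂Ev, mem_inter_iff, mem_setOf_eq, hins htω, mem_insert_iff, het, false_or, true_or]
    tauto
  -- (E4) `#((v,A) ∩ {o ≁ w in ω})` is the claw cell on the first class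
  have E4 : fibreCount (insert s(v, y) M') u₀ (forestEv V ∩ {ω | s(o, v) ∈ ω} ∩ {ω | s(v, y) ∈ ω} ∩ (reachEv o w)ᶜ)
        (forestEv V ∩ {ω | s(o, y) ∈ ω}) =
      fibreCount M' u₀ (forestEv V ∩ sep₃Ev w v y ∩ {ω | s(o, v) ∈ ω}) (forestEv V ∩ {ω | s(o, y) ∈ ω}) := by
    rw [fibreCount_insert_one htM, fibreCount_eq_zero_of_forall _ _
      ({ω | s(v, y) ∉ ω} ∩ (forestEv V ∩ {ω | s(o, v) ∈ ω} ∩ {ω | s(v, y) ∈ ω} ∩ (reachEv o w)ᶜ)) _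
      fun ω _ hA _ => hA.1 hA.2.1.2, add_zero]
    refine fibreCount_congr_fibre M' u₀ fun ω hω => ?_
    obtain ⟨htω, htη⟩ := hguard ω hω
    obtain ⟨s1, s2, -, t1, t2, -, -, -⟩ := reach_facts ω
    have hRov' : s(o, v) ∈ ω → (openGraph ω).Reachable o v := fun h => hRov h
    clear reach_facts hRov hRoy WT Z1 Z2 E1 E2 E3 hins hmem hguard hd hd' hD
    simp only [forestEv, sep₃Ev, mem_inter_iff, mem_setOf_eq, isForestCfg_insert_iff hvy htω, mem_insert_iff, het, false_or, true_or,
      and_true, mem_compl_iff, mem_reachEv, KNSep.reachable_insert_iff]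
    tauto
  -- (E5) `#(y,B)` is the pair cell on the second class with `f`
  have E5 : fibreCount (insert s(v, y) M') u₀ (forestEv V ∩ {ω | s(o, v) ∈ ω} ∩ {ω | s(v, y) ∉ ω}) (forestEv V ∩ {ω | s(o, y) ∈ ω}) =
      fibreCount M' u₀ (forestEv V ∩ {ω | s(o, v) ∈ ω}) (forestEv V ∩ sep₂Ev v y ∩ {ω | s(o, y) ∈ ω}) := by
    rw [fibreCount_insert_one htM, fibreCount_eq_zero_of_forall _ _ _ _ fun ω _ hA _ => hA.2.2 (mem_insert _ _), zero_add]
    refine fibreCount_congr_fibre M' u₀ fun ω hω => ?_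
    obtain ⟨htω, htη⟩ := hguard ω hω
    simp only [forestEv, sep₂Ev, mem_inter_iff, mem_setOf_eq, hins htη, mem_insert_iff, hft, false_or]
    tauto
  -- (E6) `#((y,B) ∩ {o ≁ w in ω ∆ M})` is the claw cell on the second class with `f`
  have E6 : fibreCount (insert s(v, y) M') u₀ (forestEv V ∩ {ω | s(o, v) ∈ ω} ∩ {ω | s(v, y) ∉ ω})
        (forestEv V ∩ {ω | s(o, y) ∈ ω} ∩ (reachEv o w)ᶜ) =
      fibreCount M' u₀ (forestEv V ∩ {ω | s(o, v) ∈ ω}) (forestEv V ∩ sep₃Ev w v y ∩ {ω | s(o, y) ∈ ω}) := by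
    rw [fibreCount_insert_one htM, fibreCount_eq_zero_of_forall _ _ _ _ fun ω _ hA _ => hA.2.2 (mem_insert _ _), zero_add]
    refine fibreCount_congr_fibre M' u₀ fun ω hω => ?_
    obtain ⟨htω, htη⟩ := hguard ω hω
    constructor
    · rintro ⟨⟨-, ⟨hF, he⟩, -⟩, -, ⟨hFi, hfi⟩, hR⟩
      have hB := (hins htη).1 hFi
      have hf : s(o, y) ∈ ω ∆ M' := (mem_insert_iff.1 hfi).resolve_left hft
      refine ⟨⟨hF, he⟩, ⟨hB.1, fun h => ?_, fun h => ?_, hB.2⟩, hf⟩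
      · exact hR ((KNSep.reachable_insert_iff _ _ _ _ _).2 (Or.inr (Or.inr ⟨hRoy hf, h.symm⟩)))
      · exact hR ((KNSep.reachable_insert_iff _ _ _ _ _).2 (Or.inl ((hRoy hf).trans h.symm)))
    · rintro ⟨⟨hF, he⟩, ⟨hB, hwv, hwy, hvy'⟩, hf⟩
      refine ⟨⟨htω, ⟨hF, he⟩, htω⟩, htη, ⟨(hins htη).2 ⟨hB, hvy'⟩, mem_insert_of_mem _ hf⟩, fun h => ?_⟩
      rcases (KNSep.reachable_insert_iff _ _ _ _ _).1 h with h' | ⟨-, h2⟩ | ⟨-, h2⟩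
      · exact hwy (h'.symm.trans (hRoy hf))
      · exact hwy h2.symm
      · exact hwv h2.symm
  unfold TwoCellIneq
  rw [Z1, Z2, ← E1, ← E2, ← E3, ← E4, ← E5, ← E6]
  omega

end TwoCell

end FK
end Summit.CriticalPhenomena.PercolationContinuityZ3.Theorems

end
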